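import Summits.BirchSwinnertonDyer.Rank1Residual.WAll.Target
import Summits.BirchSwinnertonDyer.Rank1Residual.WAll.AltClosersPre
import Summits.BirchSwinnertonDyer.BirchSwinnertonDyer.Theorems.SignedLowerHalvesRowC3BSTWScopeS
import Literature.NumberTheory.EllipticCurves.BurungaleSkinnerTianWan2024.IntroductionTheoremsOPEN
import Literature.NumberTheory.EllipticCurves.BurungaleSkinnerTianWan2024.QuadraticTwistPPartOPEN
import Literature.NumberTheory.EllipticCurves.Rank1Residual.Typed.X7
import Summits.BirchSwinnertonDyer.BirchSwinnertonDyer.Theorems.SignedLowerHalvesKobayashiLowerHalfLargeImageBSTWTwistScopedShape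
import HarnessLib

/-!
# Rung W-ALL (D-0120): the ALT-CLOSERS BY NAME that Burungale–Skinner–Tian–Wan 2024 supplies
# (cell `bsd-litref`, paper sub-dir `bstw24`, seat `bsd-litref-bstw24-pv` = the T2b prover
# «re-route consumers to the refereed statement»; companion to `WAll/AltClosers*.lean` of cell `bsd-wall`)

HONEST FRAMING (programme BSD-LIT2PART v1 §HONESTY; cell `bsd-wall` WALL-BRIEF-v1 §2). NOTHING ASSERTED, nothing
booked: every declaration is a `theorem` whose hypotheses are (i) the tree's explicitly labelled OPEN binders for
statements of the PREPRINT Burungale–Skinner–Tian–Wan, «Zeta elements for elliptic curves and applications»,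
arXiv:2409.01350v2 (each a `def … : Prop`, `[claim: …, status: under-review]`, NEVER a theorem), and (ii) the tree's
named PUBLISHED facts; and whose conclusion is a W-ALL exclusion class of `WAll/Target.lean` (seat bsd-wall-ty-1,
p488678) or an explicit SUB-CASE of one, spelled in that file's binder shape. No `def`, no `@[conjecture]`, no named
fact is introduced (D-0026); nothing is restated — every proof is a composition of landed consumers BY NAME. Each
closer is therefore CONDITIONAL on a preprint: typed ≠ proved ≠ endorsed; BSD is not proved for any curve here.

WHAT BSTW24 BITES ON, row by row of `WAll/Target.lean` (the cell's consumer census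
`pub/bsd-litref/bstw24/staging/bsd-litref-bstw24-pv/CONSUMERS.md` v1.6 §7.3 has file:line for every decl):
* **Row 6 «X6 ∧ r = 0»** (good supersingular, semistable, `p` odd, `a₃ = 0` at `3`): Thm. 1.3 (Kobayashi's main
  conjecture for semistable `E`) — here through the two S-SCOPED tier binders
  `Supersingular.BurungaleSkinnerTianWan2024_thm13_scopedS_OPEN` (`p ≥ 5`: the regime of the cell's line-by-line
  verification, bsd-ssimc REPORT-bstw-6 / -9 PASS, bsd-litref referee round C4-R3 (ζ) PASS-in-cell) and
  `…_scopedAtThreeS_OPEN` (`p = 3`; its located `p = 3` inputs are kept current in its own docstring), via the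
  odd-prime dispatcher `BirchSwinnertonDyer.Theorems.X6_bsdp_of_tiersS_S3_of_analyticRank_eq_zero` (p489313):
  `wallCornerX6r0_of_bstw13TiersS_S3` closes `WAllCornerX6r0` WHOLE (modulo the two PRE tiers + PUB facts);
  `cornerX6r0_of_bstw13TiersS_S3` is the same in `CornersAll`'s binder shape (with leaf `NonCMAtTwo` for `p = 2`,
  as in `cornerX6r0_of_signedSupersingular`); `wallCornerX6r0_of_bstw13_OPEN` reads it from the PRINTED binder.
* **Row 7 «X7»** (good supersingular, NOT semistable): ONLY the quadratic-twist sub-family — Cor. 10.2's twist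
  clause, BODY wording (`BurungaleSkinnerTianWan2024.cor102_twist_pPart_OPEN`: `E = E₀ ⊗ χ_d`, `E₀` semistable with
  `a_p(E₀) = 0`, `d ≠ 1` square-free, every prime ramified in `ℚ(√d)` prime to `N₀ p`):
  `cornerX7_bodyTwist_of_bstwCor102_OPEN`. (The Introduction's narrower clause, Thm. 1.3 / 1.5 «only ordinary primes
  divide `d_K`», is `thm15_twist_pPart_OPEN` / `Supersingular.BurungaleSkinnerTianWan2024_thm13_twist_OPEN`, implied by
  the body clause: `thm15_twist_of_cor102_twist_OPEN`.) The twist clause is NOT refereed in cell (statement audit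
  only, C4-R3 (α): binders weaker-than-print).
* **Row 8 «X8»** (`a₃ = ±3`): nothing (Thm. 1.3 at `3` needs `a₃ = 0`).
* **Rows 9 / 10, rank-one branch with a (ram) prime**: Thm. 1.9 (= Thm. 11.12, ordinary branch;
  `BurungaleSkinnerTianWan2024.thm19_pPart_rankOne_ordinary_OPEN`: `p ∤ 2N` good ordinary, (irr_ℚ), (ram), `r = 1` —
  NO semistability, NO surjectivity, NO `p ≥ 5`): `cornerX9_rankOne_ram_of_bstw19_OPEN`,
  `cornerX10b_rankOne_ram_of_bstw19_OPEN`. Outside the cell's tranche T2b (not refereed in cell).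
* **Row 2 «additive», rank zero, a quadratic-twist prime**: Thm. 9.21 (c)'s twist clause as used in the proof of
  Thm. 10.12 (`BurungaleSkinnerTianWan2024.thm921cTwist_pPartRankZero_OPEN`, localised reading: `E = E₀ ⊗ χ_M`, `E₀`
  semistable, `p ∣ M`, `p ≥ 5` good ordinary for `E₀`, (irr_ℚ), (ram_K), `L(E,1) ≠ 0` — an ADDITIVE, potentially
  good ordinary pair): `exclAdditive_twistPrimeRankZero_of_bstw921c_OPEN`. Not refereed in cell.
* Rows 4 / 5 (Eisenstein X1 / X2): BSTW §5 is the NODE behind Castella–Grossi–Skinner 2025 Thm. A (`hA`; at `p = 3`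
  the typed binder `RowC6.CastellaGrossiSkinner2025_thmA_atThree_OPEN`, GAP(line) of record C4-R3 (β) / referee A
  R430) — the closers there are the Eisenstein lanes' decls, not BSTW statements. Rows 3 / 11 / 12: nothing (Thm.
  11.12 needs good reduction at `p`).

PRIORITY / OVERLAP NOTE (recorded at once, 2026-08-27T03:2xZ): cell `bsd-wall`'s seat ty-2 landed
`WAll/AltClosersPre.lean` (p489766, 03:00Z) from this seat's W-ALL DATA line ten minutes BEFORE this file (p490601,
03:10Z); three statements here coincide with theirs and are therefore proved BY their theorems (aliases kept only so
that the BSTW24 lane's closers read in one place; the registry name of record is ty-2's): `wallCornerX6r0_of_bstw13TiersS_S3`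
= `wallCornerX6r0_of_BSTW13_tiers`, `cornerX9_rankOne_ram_of_bstw19_OPEN` = `cornerX9_rankOne_ram_of_BSTW19`,
`cornerX10b_rankOne_ram_of_bstw19_OPEN` = `cornerX10b_rankOne_ram_of_BSTW19` (theirs without the unused `¬ W.HasCM`
binder). NEW in this file relative to `AltClosersPre.lean`: `cornerX6r0_of_bstw13TiersS_S3` (CornersAll shape),
`wallCornerX6r0_of_bstw13_OPEN` (as printed), `cornerX7_bodyTwist_of_bstwCor102_OPEN` (row 7),
`exclAdditive_twistPrimeRankZero_of_bstw921c_OPEN` (row 2).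

References: WALL-BRIEF-v1.md §0/§2 (pub/ladder-directors/, b966bf16da27706e); `WAll/Target.lean`, `WAll/AltClosers.lean`,
`WAll/AltClosersGlue.lean` (cell bsd-wall); [BurungaleSkinnerTianWan2024] Thm. 1.3 / 1.5 / 1.9, Thm. 9.21 (c),
Cor. 10.2, Thm. 10.12, Thm. 11.12 (PRE); [Wuthrich2014] Prop. 21; [Kobayashi2003] Thm. 1.2; [BDKim2013] Cor. 3.15;
[Pollack2003] Thm. 5.6; [BurungaleKobayashiOta2023] Cor. A.5; [Miller2011LMS] Def. 1.1; [Serre1972] §1.11 Prop. 12.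
-/

set_option autoImplicit false

noncomputable section

open scoped Classical

open WeierstrassCurve Literature.NumberTheory.EllipticCurves
  Literature.NumberTheory.EllipticCurves.Rank1Residual
  Literature.NumberTheory.EllipticCurves.Rank1Residual.Typed
  Literature.NumberTheory.EllipticCurves.ModularForms
  Literature.NumberTheory.EllipticCurves.BurungaleSkinnerTianWan2024

namespace Summit.BirchSwinnertonDyer.Rank1Residual.WAll

open Summit.BirchSwinnertonDyer
open Summit.BirchSwinnertonDyer.Rank1Residual
open Summit.BirchSwinnertonDyer.Rank1Residual.Supersingular
open Summit.BirchSwinnertonDyer.BirchSwinnertonDyer.Rank1Residual (NonCMAtTwo)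
open Summit.BirchSwinnertonDyer.BirchSwinnertonDyer.Theorems (X6_bsdp_of_tiersS_S3_of_analyticRank_eq_zero)

/-! ## §6 — row 6 «X6 ∧ r = 0» from BSTW Thm. 1.3 through the two S-scoped tier binders -/

/-- **Row 6 `WAllCornerX6r0` ⇐ BSTW Thm. 1.3, S-scoped tiers** (`h5t` : `p ≥ 5` tier, the cell-refereed regime;
`h3t` : `p = 3` tier) + PUBLISHED facts by name (Wuthrich 2014 Prop. 21 `hW`, Kobayashi 2003 Thm. 1.2 `h12`,
B. D. Kim 2013 Cor. 3.15 `hKim`, modularity `hmodP` / `hmod'` / `hmod`, Gross–Zagier–Kolyvagin `hGZK`, Diamond 1995 /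
Ribet 1990 `hLL`; Pollack 2003 is discharged inside the dispatcher by the tree theorem
`pollack_exists_plusMinusPAdicLFunction_holds`). Definitional over
`BirchSwinnertonDyer.Theorems.X6_bsdp_of_tiersS_S3_of_analyticRank_eq_zero` (the `¬ W.HasCM` binder is not used);
SAME STATEMENT as bsd-wall ty-2's `wallCornerX6r0_of_BSTW13_tiers` (`AltClosersPre.lean`, p489766, landed first) and
proved BY it — an alias, kept for the lane's one-place reading; cite ty-2's name in registries.
CONDITIONAL on two PRE binders; closes nothing; books nothing. [claim: BurungaleSkinnerTianWan2024, status: under-review]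
[cite: Wuthrich2014, Prop. 21 (p. 400)] [cite: Kobayashi2003, Thm. 1.2] [cite: Miller2011LMS, §1 and Def. 1.1] -/
theorem wallCornerX6r0_of_bstw13TiersS_S3
    (h5t : BurungaleSkinnerTianWan2024_thm13_scopedS_OPEN)
    (h3t : BurungaleSkinnerTianWan2024_thm13_scopedAtThreeS_OPEN)
    (hW : Wuthrich2014.sha_dvd_analyticSha)
    (h12 : Kobayashi2003.thm12_signedSelmerDual_finite_torsion)
    (hKim : BDKim2013.cor315_signedCharValue_rankZero)
    (hmodP : nonempty_modularParametrizationData) (hmod' : hasEntireLFunction_rat)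
    (hGZK : rank_eq_analyticRank_of_analyticRank_le_one)
    (hmod : exists_isNewformOf) (hLL : Literature.NumberTheory.Automorphic.diamond1995_refinedSerre) :
    WAllCornerX6r0 :=
  wallCornerX6r0_of_BSTW13_tiers h5t h3t hW h12 hKim hmodP hmod' hGZK hmod hLL

/-- **Corner X6 ∧ r = 0 in `CornersAll`'s binder shape ⇐ BSTW Thm. 1.3 S-scoped tiers + leaf K4 `NonCMAtTwo`**
(which disposes of `p = 2`, where `ClassX6 W 2` is possible when `a₃ = 0` — exactly as in
`cornerX6r0_of_signedSupersingular`). Same published facts as `wallCornerX6r0_of_bstw13TiersS_S3`. CONDITIONAL;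
closes nothing. [claim: BurungaleSkinnerTianWan2024, status: under-review] [cite: Wuthrich2014, Prop. 21 (p. 400)]
[cite: Miller2011LMS, §1 and Def. 1.1] -/
theorem cornerX6r0_of_bstw13TiersS_S3
    (h5t : BurungaleSkinnerTianWan2024_thm13_scopedS_OPEN)
    (h3t : BurungaleSkinnerTianWan2024_thm13_scopedAtThreeS_OPEN)
    (hW : Wuthrich2014.sha_dvd_analyticSha)
    (h12 : Kobayashi2003.thm12_signedSelmerDual_finite_torsion)
    (hKim : BDKim2013.cor315_signedCharValue_rankZero)
    (hmodP : nonempty_modularParametrizationData) (hmod' : hasEntireLFunction_rat)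
    (hGZK : rank_eq_analyticRank_of_analyticRank_le_one)
    (hmod : exists_isNewformOf) (hLL : Literature.NumberTheory.Automorphic.diamond1995_refinedSerre)
    (h2 : NonCMAtTwo) :
    ∀ (W : WeierstrassCurve ℚ) [W.IsElliptic] [W.IsGloballyMinimal] (p : ℕ) [Fact p.Prime],
      ¬ W.HasCM → (ClassX6 W p ∧ W.analyticRank = 0) → W.analyticRank ≤ 1 → BSDp W p := by
  rintro W _ _ p _ hcm ⟨hX, h0⟩ hr
  by_cases hp : p = 2
  · subst hp; exact h2 W hcm hr
  · exact X6_bsdp_of_tiersS_S3_of_analyticRank_eq_zero h5t h3t hW h12 hKim hmodP hmod' hGZK hmod hLL W p hp hX h0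

/-- **Row 6 ⇐ BSTW Thm. 1.3 AS PRINTED** (the printed binder `Supersingular.BurungaleSkinnerTianWan2024_thm13_OPEN`
implies both S-scoped tiers: `thm13_scopedS_OPEN_of_thm13_OPEN`, `thm13_scopedAtThreeS_OPEN_of_thm13_OPEN`) — sanity:
the re-routed road is never stronger than the print. CONDITIONAL; closes nothing.
[claim: BurungaleSkinnerTianWan2024, status: under-review] [cite: Miller2011LMS, §1 and Def. 1.1] -/
theorem wallCornerX6r0_of_bstw13_OPEN
    (h : BurungaleSkinnerTianWan2024_thm13_OPEN)
    (hW : Wuthrich2014.sha_dvd_analyticSha)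
    (h12 : Kobayashi2003.thm12_signedSelmerDual_finite_torsion)
    (hKim : BDKim2013.cor315_signedCharValue_rankZero)
    (hmodP : nonempty_modularParametrizationData) (hmod' : hasEntireLFunction_rat)
    (hGZK : rank_eq_analyticRank_of_analyticRank_le_one)
    (hmod : exists_isNewformOf) (hLL : Literature.NumberTheory.Automorphic.diamond1995_refinedSerre) :
    WAllCornerX6r0 :=
  wallCornerX6r0_of_bstw13TiersS_S3 (thm13_scopedS_OPEN_of_thm13_OPEN h) (thm13_scopedAtThreeS_OPEN_of_thm13_OPEN h)
    hW h12 hKim hmodP hmod' hGZK hmod hLL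

/-! ## §7 — row 7 «X7», the quadratic-twist sub-family, from Cor. 10.2's twist clause (BODY wording) -/

/-- **Row 7 sub-case ⇐ BSTW Cor. 10.2, twist clause, body wording** (`h`, PRE, NOT refereed in cell): on class X7
at an odd `p`, every pair `(W, p)` carrying a BSTW twist datum — `W` a globally minimal model of `E₀ ⊗ χ_d` with
`E₀` (`W₀`) semistable, good at `p` with `a_p(E₀) = 0`, `d ≠ 1` square-free, every prime ramified in `ℚ(√d)`
different from `p` and prime to `N(E₀)` — satisfies `BSD(W,p)` in analytic rank `≤ 1`, via the Literature bridge
`BurungaleSkinnerTianWan2024.bsdp_of_cor102_twist_OPEN` (GZK `hGZK`); `E[p]` irreducible is automatic on X7 at odd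
`p` (`ClassX7.irr`, Serre 1972 §1.11 Prop. 12). The datum is spelled as an explicit `∃` over the binder's own
hypotheses (no new predicate). CONDITIONAL; closes nothing; books nothing.
[claim: BurungaleSkinnerTianWan2024, status: under-review] [cite: Serre1972, §1.11 Prop. 12] [cite: Miller2011LMS, §1 and Def. 1.1] -/
theorem cornerX7_bodyTwist_of_bstwCor102_OPEN (h : cor102_twist_pPart_OPEN)
    (hGZK : rank_eq_analyticRank_of_analyticRank_le_one) :
    ∀ (W : WeierstrassCurve ℚ) [W.IsElliptic] [W.IsGloballyMinimal] (p : ℕ) [Fact p.Prime],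
      ¬ W.HasCM → p ≠ 2 → ClassX7 W p → W.analyticRank ≤ 1 →
      (∃ (W₀ : WeierstrassCurve ℚ) (_ : W₀.IsElliptic) (_ : W₀.IsGloballyMinimal) (d : ℤ) (C : VariableChange ℚ),
          Semistable W₀ ∧ W₀.HasGoodReductionAtPrime p ∧ W₀.frobeniusTrace p = 0 ∧ Squarefree d ∧ d ≠ 1 ∧
          (∀ (q : ℕ) [Fact q.Prime], RamifiedInQuadratic d q → q ≠ p ∧ ¬ q ∣ W₀.conductorNorm ℤ) ∧
          C • W = W₀.quadraticTwist (d : ℚ)) →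
      BSDp W p := by
  intro W _ _ p _ _ hp hX hr hdat
  obtain ⟨W₀, _, _, d, C, hsst, hgood, hap, hd, hd1, hram, hC⟩ := hdat
  exact bsdp_of_cor102_twist_OPEN h hGZK W₀ W p hp hsst hgood hap hd hd1 (fun q _ hq ↦ hram q hq) hC
    (ClassX7.irr W p hp hX) hr

/-! ## §9 / §10 — rows 9 and 10, rank-one branch with a (ram) prime, from Thm. 1.9 (= Thm. 11.12, ordinary) -/

/-- **Row 9 sub-case ⇐ BSTW Thm. 1.9** (`h`, PRE, not refereed in cell): on class X9 (non-CM, good ordinary `p ≥ 5`,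
`E[p]` irreducible, `ρ̄` not surjective, non-semistable in rank one) the analytic-rank-ONE pairs having a (ram)
prime (`Ram W p`: some `ℓ ∥ N` with `p ∤ v_ℓ(Δ)`) satisfy `BSD(E,p)` — Thm. 1.9 asks neither semistability nor
surjectivity nor `p ≥ 5`; via `BurungaleSkinnerTianWan2024.bsdp_of_thm19_OPEN` (GZK `hGZK`). SAME STATEMENT as
bsd-wall ty-2's `cornerX9_rankOne_ram_of_BSTW19` (`AltClosersPre.lean`, p489766, landed first) and proved BY it — an
alias; cite ty-2's name in registries. CONDITIONAL; closes nothing.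
[claim: BurungaleSkinnerTianWan2024, status: under-review] [cite: Miller2011LMS, §1 and Def. 1.1] -/
theorem cornerX9_rankOne_ram_of_bstw19_OPEN (h : thm19_pPart_rankOne_ordinary_OPEN)
    (hGZK : rank_eq_analyticRank_of_analyticRank_le_one) :
    ∀ (W : WeierstrassCurve ℚ) [W.IsElliptic] [W.IsGloballyMinimal] (p : ℕ) [Fact p.Prime],
      ClassX9 W p → W.analyticRank = 1 → Ram W p → BSDp W p :=
  cornerX9_rankOne_ram_of_BSTW19 h hGZK

/-- **Row 10 sub-case ⇐ BSTW Thm. 1.9** (`h`, PRE, not refereed in cell): on corner X10 ∧ ¬Surj (`p = 3` good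
ordinary, `E[3]` irreducible, `ρ̄_{E,3}` not surjective) the analytic-rank-ONE pairs having a (ram) prime at `3`
satisfy `BSD(E,3)` — via `BurungaleSkinnerTianWan2024.bsdp_of_thm19_OPEN` at `p = 3` (GZK `hGZK`); the `¬ W.HasCM` and
`¬ Surj` binders are not used. SAME CONTENT as bsd-wall ty-2's `cornerX10b_rankOne_ram_of_BSTW19` (`AltClosersPre.lean`,
p489766, landed first; theirs omits the idle `¬ W.HasCM` binder) and proved BY it; cite ty-2's name in registries.
CONDITIONAL; closes nothing. [claim: BurungaleSkinnerTianWan2024, status: under-review] [cite: Miller2011LMS, §1 and Def. 1.1] -/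
theorem cornerX10b_rankOne_ram_of_bstw19_OPEN (h : thm19_pPart_rankOne_ordinary_OPEN)
    (hGZK : rank_eq_analyticRank_of_analyticRank_le_one) :
    ∀ (W : WeierstrassCurve ℚ) [W.IsElliptic] [W.IsGloballyMinimal] (p : ℕ) [Fact p.Prime],
      ¬ W.HasCM → ClassX10 W p → ¬ Surj W p → W.analyticRank = 1 → Ram W p → BSDp W p :=
  fun W _ _ p _ _ hX hns h1 hram ↦ cornerX10b_rankOne_ram_of_BSTW19 h hGZK W p hX hns h1 hram

/-! ## §2 — row 2 «additive», rank zero at a quadratic-twist prime, from Thm. 9.21 (c) / proof of Thm. 10.12 -/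

/-- **Row 2 sub-case ⇐ BSTW Thm. 9.21 (c) twist clause as used in the proof of Thm. 10.12** (`h` =
`thm921cTwist_pPartRankZero_OPEN`, localised reading, PRE, not refereed in cell): at an odd additive prime `p` of a
non-CM `W` of analytic rank `≤ 1`, every pair carrying the datum — `W` a globally minimal model of `E₀ ⊗ χ_M`, `E₀`
(`W₀`) semistable, `M > 1` square-free and prime to `N(E₀)`, `L(W,1) ≠ 0`, `p ∣ M`, `p ≥ 5` good ordinary for `E₀`,
`E₀[p]` irreducible, and (ram_K): a multiplicative prime `ℓ ≠ p` of `E₀` with `p ∤ v_ℓ(Δ)` unramified in `ℚ(√M)` —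
satisfies `BSD(W,p)`, via `BurungaleSkinnerTianWan2024.bsdp_of_thm921cTwist_OPEN` (modularity `hmod`, GZK `hGZK`). Such
a `p` is a potentially-good-ordinary ADDITIVE prime of `W` (type `I₀*`); the `Addv` / rank binders of the row are not
used by the proof (the datum forces them). CONDITIONAL; closes nothing; books nothing.
[claim: BurungaleSkinnerTianWan2024, status: under-review] [cite: Miller2011LMS, §1 and Def. 1.1] -/
theorem exclAdditive_twistPrimeRankZero_of_bstw921c_OPEN (h : thm921cTwist_pPartRankZero_OPEN)
    (hmod : hasEntireLFunction_rat) (hGZK : rank_eq_analyticRank_of_analyticRank_le_one) :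
    ∀ (W : WeierstrassCurve ℚ) [W.IsElliptic] [W.IsGloballyMinimal] (p : ℕ) [Fact p.Prime],
      ¬ W.HasCM → p ≠ 2 → Addv W p → W.analyticRank ≤ 1 →
      (∃ (W₀ : WeierstrassCurve ℚ) (_ : W₀.IsElliptic) (_ : W₀.IsGloballyMinimal) (M : ℕ) (C : VariableChange ℚ),
          Semistable W₀ ∧ 1 < M ∧ Squarefree M ∧ Nat.Coprime M (W₀.conductorNorm ℤ) ∧
          C • W = W₀.quadraticTwist (M : ℚ) ∧ W.entireLFunction 1 ≠ 0 ∧ 5 ≤ p ∧ p ∣ M ∧ GoodOrd W₀ p ∧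
          Irr W₀ p ∧
          (∃ ℓ : ℕ, ∃ _ : Fact ℓ.Prime, ℓ ≠ p ∧ W₀.HasMultiplicativeReductionAtPrime ℓ ∧
            ¬ p ∣ padicValInt ℓ W₀.minimalDiscriminantInt ∧ ¬ RamifiedInQuadratic (M : ℤ) ℓ)) →
      BSDp W p := by
  intro W _ _ p _ _ _ _ _ hdat
  obtain ⟨W₀, _, _, M, C, hsst, hM, hsq, hcop, hC, hL, hp5, hpM, hord, hirr, hramK⟩ := hdat
  exact bsdp_of_thm921cTwist_OPEN W₀ W p h hmod hGZK hsst hM hsq hcop hC hL hp5 hpM hord hirr hramK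

/-! ## APPEND (bsd-litref-bstw24-pv gen 6, 2026-08-27): row 7 RE-ROUTED TO THE CELL-REFEREED STATEMENT — the twist clause on the
litref D-audit's gap-free scope `S_tw` (referee C4 ROUND C4-R3-ADD-6 (γ): road B2 PASS-in-cell(scope S_tw^aux); (b) scope object named =
`BSTWScope.IsAuxiliaryTwist`, typed in `Supersingular/KobayashiMainConjectureX7BSTWScopeS.lean`, p500588; per-pair scope certificates:
`Theorems/SignedLowerHalvesKobayashiLowerHalfLargeImageBSTWTwistScopedShape.lean` p501067 / `…ScopedRecords01.lean` p501666) -/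

/-- **Row 7 sub-family ⇐ BSTW Cor. 10.2's twist clause ON THE LITREF SCOPE (road B2, cell-refereed at `p ≥ 5`; at `p = 3` resting on
the `p = 3` wall of record).** On class X7 (good supersingular `p` odd, `E` NOT semistable) the pairs `(E, p)` carrying a SCOPED twist
datum — `E ≅ E₀^{(d)}` with `E₀` semistable, `p` good supersingular for `E₀` with `a_p(E₀) = 0`, `d` square-free `≠ 1`, every prime
ramified in `ℚ(√d)` `≠ p` and good for `E₀`, AND `ℚ(√d)` itself an admissible auxiliary field of BSTW §10.3 for `(E₀, p)`
(`BSTWScope.IsAuxiliaryTwist E₀ p d`) — satisfy `BSD(E, p)` in analytic rank `≤ 1`, granted the two S_tw-scoped tiers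
`BurungaleSkinnerTianWan2024_cor102_twist_scopedS_OPEN` (`p ≥ 5`; litref verdict PASS-in-cell(scope) modulo the untwisted tier S5) and
`…_scopedAtThreeS_OPEN` (`p = 3`; modulo S3, GAP(line) at 3 of record) and GZK (`hGZK`): dispatch on `p = 3` / `p ≥ 5` to
`X7Twist.bsdp_of_cor102_twist_scoped{AtThreeS,S}_OPEN_of_twistAux`. This is the row-7 closer `cornerX7_bodyTwist_of_bstwCor102_OPEN`
RE-ROUTED from the printed binder (road B1, GAP(line) T1 ∧ T2b per C4-R3-ADD-6 (β)) to the cell-refereed scoped statement; the scope is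
decidable per pair (census footprint: 5 of the 415 BSTW-twist X7 pairs, `…BSTWTwistScopedRecords01.lean`). `¬CM`, `ClassX7` are carried
unused (the datum implies them). CONDITIONAL on PRE binders; closes nothing; the row-7 leaf `WAllCornerX7` is class-wide and stays OPEN.
[claim: BurungaleSkinnerTianWan2024, status: under-review]
[cite: BurungaleSkinnerTianWan2024, Cor. 10.2, last sentence (p. 86) with §10.3 (l.7454–7479) (ANNOUNCED, OPEN binders, scoped)]
[cite: Miller2011LMS, §1 and Def. 1.1] -/
theorem cornerX7_auxTwist_of_bstwCor102Scoped_OPEN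
    (h5 : BurungaleSkinnerTianWan2024_cor102_twist_scopedS_OPEN)
    (h3 : BurungaleSkinnerTianWan2024_cor102_twist_scopedAtThreeS_OPEN)
    (hGZK : rank_eq_analyticRank_of_analyticRank_le_one) :
    ∀ (W : WeierstrassCurve ℚ) [W.IsElliptic] [W.IsGloballyMinimal] (p : ℕ) [Fact p.Prime],
      ¬ W.HasCM → p ≠ 2 → ClassX7 W p → W.analyticRank ≤ 1 →
      (∃ (W₀ : WeierstrassCurve ℚ) (_ : W₀.IsElliptic) (_ : W₀.IsGloballyMinimal) (d : ℤ) (C : VariableChange ℚ),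
          Semistable W₀ ∧ GoodSS W₀ p ∧ W₀.frobeniusTrace p = 0 ∧ Squarefree d ∧ d ≠ 1 ∧
          (∀ (q : ℕ) [Fact q.Prime], RamifiedInQuadratic d q → q ≠ p ∧ W₀.HasGoodReductionAtPrime q) ∧
          C • W = W₀.quadraticTwist (d : ℚ) ∧ BSTWScope.IsAuxiliaryTwist W₀ p d) →
      BSDp W p := by
  intro W _ _ p _ _ hp _ hr hdat
  have hpP : p.Prime := Fact.out
  by_cases hp3 : p = 3
  · exact Summit.BirchSwinnertonDyer.BirchSwinnertonDyer.Theorems.X7Twist.bsdp_of_cor102_twist_scopedAtThreeS_OPEN_of_twistAux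
      W p h3 hGZK hp3 hdat rfl hr
  · have h2 := hpP.two_le
    have hp5 : 5 ≤ p := by
      by_contra hlt
      interval_cases p
      · exact absurd rfl hp
      · exact absurd rfl hp3
      · exact absurd hpP (by decide)
    exact Summit.BirchSwinnertonDyer.BirchSwinnertonDyer.Theorems.X7Twist.bsdp_of_cor102_twist_scopedS_OPEN_of_twistAux
      W p h5 hGZK hp5 hdat rfl hr

end Summit.BirchSwinnertonDyer.Rank1Residual.WAll

end
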